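import Summits.Parity.BatemanHorn.Theorems.RoughParitySectorsOddSectorShareLinearSieveDecouplingPrimeAux1
import Summits.Parity.BatemanHorn.Theorems.RoughParitySectorsOddSectorShareLinearSieveDecouplingPrimeAux2
import Summits.Parity.BatemanHorn.Theorems.RoughValueTransportRoughValueLawLinearCells
import HarnessLib

/-!
# Route `RoughParitySectors`, crux `OddSectorShareLinear` (stmt-Parity-15629), line `birth`:
# helpers II for the stub `stub_sieveDecouplingOdd_of_roughCellsBV` — the classes of the odd cell

`--supports stmt-Parity-15629`.  The stub S'b sifts the `k − 1` members `fᵢ`, `i ≠ m`, out of the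
sequence `ℬ = {1 ≤ n ≤ x : f_m(n) > 0 free of primes < z, Ω(f_m(n)) odd}` (`f_m = αX + β`, `α ≥ 1`)
by the primes `p < z`, removing the classes `Ω p = {c mod p : p ∤ f_m(c), ∃ i ≠ m, p ∣ fᵢ(c)}`
(density `g(p) = #Ω p/#Φ p`, `Φ p = {c mod p : p ∤ f_m(c)}`, exactly as on the prime side S'a,
files `…SieveDecouplingPrimeAux1–4`).  This file is the odd-side twin of `…PrimeAux2/3`:

* `coprime_of_mem_roughIcc`, `filter_and_coprime_eq` — a `z`-rough number is prime to every
  modulus all of whose prime factors are `< z` (so the coprimality condition of the main term of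
  the rough-cell Bombieri–Vinogradov theorem is vacuous for the moduli `αd`, `d ∣ P(z)`, `z > α`);
* `card_filter_mod_eq` — `#{n ∈ ℬ : n ≡ c (d)} = #{b ∈ roughIcc z (αx+β) : Ω(b) odd, b ≡ αc + β (αd)}`
  (the bijection `n ↦ αn + β`, via `LinearCells.image_eq`);
* `abs_card_classes_sub_le` — hence, for squarefree `d` with prime factors `< z`, the count
  `#{n ∈ ℬ : n mod q ∈ Ω q ∀ q ∣ d}` is within `S^{ω(d)} E` of `g(d) X`,
  `X = #{b ∈ roughIcc z (αx+β) : Ω(b) odd}/φ(α)`, where `E` bounds the class discrepancies of the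
  odd rough numbers modulo `αd` (`φ(αd) = φ(α) ∏_{p ∣ d} #Φ p`, `…PrimeAux1`).
-/

noncomputable section

open Finset Polynomial
open scoped BigOperators
open Literature.NumberTheory.Sieve

namespace Summit.Parity.BatemanHorn.Cruxes.OddSectorShareLinear.Birth

namespace SieveDecouplingOdd

open SieveDecoupling (isUnit_linear_class card_filter_forall_mem_eq_sum card_classes_eq_prod
  card_classes_le lt_of_mem_Ω card_Ω_lt_card_Φ totient_mul_eq prod_card_le_pow)
open Summit.Parity.BatemanHorn.Cruxes.RoughValueLaw.OmegaClassShapeSplit (LinearCells.image_eq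
  LinearCells.injOn_toNat)

/-! ### Rough numbers are prime to the small moduli -/

/-- A number all of whose prime factors are `≥ z` is prime to any `q` all of whose prime factors
are `< z`. [folklore] -/
theorem coprime_of_mem_roughIcc {z y b q : ℕ} (hb : b ∈ roughIcc z y)
    (hq : ∀ p : ℕ, p.Prime → p ∣ q → p < z) : b.Coprime q :=
  Nat.coprime_of_dvd fun p hp hpb hpq =>
    absurd (hq p hp hpq) (not_lt.mpr ((mem_roughIcc.mp hb).2 p hp hpb))

/-- For `q` with all prime factors `< z` the coprimality condition is vacuous on `roughIcc z y`:
`#{b ∈ roughIcc z y : P b, (b, q) = 1} = #{b ∈ roughIcc z y : P b}`. [folklore] -/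
theorem filter_and_coprime_eq {z y q : ℕ} (hq : ∀ p : ℕ, p.Prime → p ∣ q → p < z)
    (P : ℕ → Prop) [DecidablePred P] :
    (roughIcc z y).filter (fun b => P b ∧ b.Coprime q) = (roughIcc z y).filter P :=
  filter_congr fun _ hb => and_iff_left (coprime_of_mem_roughIcc hb hq)

/-- A rough number with `Ω ≠ 0` is at least the roughness threshold: `b ∈ roughIcc z y` and
`Ω(b) ≠ 0` give `z ≤ b` (`z^{Ω(b)} ≤ b`). [folklore] -/
theorem le_of_mem_roughIcc_of_cardFactors_ne_zero {z y b : ℕ} (hb : b ∈ roughIcc z y)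
    (hΩ : ArithmeticFunction.cardFactors b ≠ 0) : z ≤ b :=
  (Nat.le_self_pow hΩ z).trans (pow_cardFactors_le_of_mem_roughIcc hb)

/-- The prime factors of `αd` are `< z` once `α < z` and all prime factors of `d` are `< z`. [folklore] -/
theorem prime_dvd_mul_lt {a d z : ℕ} (ha : 0 < a) (haz : a < z)
    (hd : ∀ p ∈ d.primeFactors, p < z) (hd0 : d ≠ 0) :
    ∀ p : ℕ, p.Prime → p ∣ a * d → p < z := fun p hp hpd => by
  rcases (Nat.Prime.dvd_mul hp).mp hpd with h | h
  · exact (Nat.le_of_dvd ha h).trans_lt haz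
  · exact hd p (Nat.mem_primeFactors.mpr ⟨hp, h, hd0⟩)

/-! ### The classes `c mod d` of `ℬ` are classes of the odd rough numbers modulo `αd` -/

/-- **The bijection `n ↦ αn + β`, odd cells.**  For `α ≥ 1`, `c < d` and `z > β`:
`#{1 ≤ n ≤ x : αn + β > 0 free of primes < z, Ω(αn + β) odd, n ≡ c (d)}`
`= #{b ∈ roughIcc z (αx + β) : Ω(b) odd, b ≡ a (αd)}` whenever `a ≡ αc + β (mod αd)`
(`LinearCells.image_eq`: the image of the sifted set is the class `β mod α` above `α + β`; the
congruence `b ≡ αc + β (αd)` forces `b ≡ β (α)`, and `b ≥ z > β` forces `b ≥ α + β`). [folklore] -/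
theorem card_filter_mod_eq {α β : ℤ} (hα : 0 < α) {x z d c a : ℕ} (hcd : c < d) (hzβ : β < z)
    (ha : ((a : ℕ) : ZMod (α.toNat * d)) = ((α * c + β : ℤ) : ZMod (α.toNat * d))) :
    #(((Icc 1 x).filter (fun n : ℕ => (0 < α * n + β ∧
        ∀ p ∈ range z, p.Prime → ¬ ((p : ℤ) ∣ α * n + β)) ∧
          Odd (ArithmeticFunction.cardFactors (α * n + β).toNat))).filter
        (fun n : ℕ => n % d = c)) =
      #((roughIcc z (α * x + β).toNat).filter (fun b : ℕ =>
        Odd (ArithmeticFunction.cardFactors b) ∧ b ≡ a [MOD α.toNat * d])) := by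
  have hαZ : ((α.toNat : ℕ) : ℤ) = α := Int.toNat_of_nonneg hα.le
  have hM : ((α.toNat * d : ℕ) : ℤ) = α * d := by push_cast; rw [hαZ]
  have key : ∀ q : ℕ, q ≡ a [MOD α.toNat * d] ↔ (α * d : ℤ) ∣ (α * c + β) - q := by
    intro q
    have e : ((q : ℕ) : ZMod (α.toNat * d)) = ((q : ℤ) : ZMod (α.toNat * d)) :=
      (Int.cast_natCast q).symm
    rw [← ZMod.natCast_eq_natCast_iff, ha, e, ZMod.intCast_eq_intCast_iff_dvd_sub, hM]
  have hy : ⌊(α : ℝ) * x + β⌋₊ = (α * x + β).toNat := by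
    rw [show (α : ℝ) * x + β = ((α * x + β : ℤ) : ℝ) by push_cast; ring, ← Int.floor_toNat,
      Int.floor_intCast]
  -- Step 1: the source is the sifted set filtered by a predicate of the value `αn + β`
  have hS : ((Icc 1 x).filter (fun n : ℕ => (0 < α * n + β ∧
        ∀ p ∈ range z, p.Prime → ¬ ((p : ℤ) ∣ α * n + β)) ∧
          Odd (ArithmeticFunction.cardFactors (α * n + β).toNat))).filter
        (fun n : ℕ => n % d = c) =
      ((Icc 1 x).filter (fun n : ℕ => 0 < α * n + β ∧
        ∀ p ∈ range z, p.Prime → ¬ ((p : ℤ) ∣ α * n + β))).filter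
        (fun n : ℕ => Odd (ArithmeticFunction.cardFactors (α * n + β).toNat) ∧
          (α * n + β).toNat ≡ a [MOD α.toNat * d]) := by
    rw [filter_filter, filter_filter]
    refine filter_congr fun n _ => ?_
    constructor
    · rintro ⟨⟨hr, ho⟩, hm⟩
      refine ⟨hr, ho, ?_⟩
      rw [key, Int.toNat_of_nonneg hr.1.le]
      have hnc : n ≡ c [MOD d] := by rw [Nat.ModEq, hm, Nat.mod_eq_of_lt hcd]
      have hdvd : (d : ℤ) ∣ (c : ℤ) - n := Nat.modEq_iff_dvd.mp hnc
      rw [show (α * c + β) - (α * n + β) = α * ((c : ℤ) - n) by ring]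
      exact mul_dvd_mul_left α hdvd
    · rintro ⟨hr, ho, hm⟩
      refine ⟨⟨hr, ho⟩, ?_⟩
      rw [key, Int.toNat_of_nonneg hr.1.le,
        show (α * c + β) - (α * n + β) = α * ((c : ℤ) - n) by ring,
        mul_dvd_mul_iff_left hα.ne'] at hm
      have hnc : n ≡ c [MOD d] := Nat.modEq_iff_dvd.mpr hm
      rw [hnc, Nat.mod_eq_of_lt hcd]
  -- Step 2: transport along the injection `n ↦ αn + β`
  have himg : #((((Icc 1 x).filter (fun n : ℕ => 0 < α * n + β ∧
        ∀ p ∈ range z, p.Prime → ¬ ((p : ℤ) ∣ α * n + β))).image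
        (fun n : ℕ => (α * n + β).toNat)).filter (fun b : ℕ =>
          Odd (ArithmeticFunction.cardFactors b) ∧ b ≡ a [MOD α.toNat * d])) =
      #(((Icc 1 x).filter (fun n : ℕ => 0 < α * n + β ∧
        ∀ p ∈ range z, p.Prime → ¬ ((p : ℤ) ∣ α * n + β))).filter
        (fun n : ℕ => Odd (ArithmeticFunction.cardFactors (α * n + β).toNat) ∧
          (α * n + β).toNat ≡ a [MOD α.toNat * d])) := by
    rw [filter_image, card_image_of_injOn ((LinearCells.injOn_toNat hα z x).mono
      (coe_subset.mpr (filter_subset _ _)))]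
  rw [hS, ← himg, LinearCells.image_eq hα z x, hy, filter_filter, filter_filter]
  -- Step 3: the two extra conditions of the image are implied
  refine congrArg card (filter_congr fun b hb => ?_)
  constructor
  · rintro ⟨-, -, ho, hm⟩
    exact ⟨ho, hm⟩
  · rintro ⟨ho, hm⟩
    have h1 : (α * d : ℤ) ∣ (α * c + β) - b := (key b).mp hm
    have h2 : α ∣ (b : ℤ) - β := by
      have h3 : α ∣ (α * c + β) - b := (dvd_mul_right α d).trans h1
      rw [show (b : ℤ) - β = α * c - ((α * c + β) - b) by ring]
      exact dvd_sub (dvd_mul_right α c) h3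
    have hΩ0 : ArithmeticFunction.cardFactors b ≠ 0 := by obtain ⟨r, hr⟩ := ho; omega
    have hzb : z ≤ b := le_of_mem_roughIcc_of_cardFactors_ne_zero hb hΩ0
    have hzb' : ((z : ℕ) : ℤ) ≤ b := by exact_mod_cast hzb
    obtain ⟨t, ht⟩ := h2
    have hbt : (b : ℤ) = β + α * t := by linarith
    refine ⟨?_, ?_, ho, hm⟩
    · rw [LinearRoughValues.modEq_toNat_iff hα, hbt, Int.add_mul_emod_self_left]
    · have ht1 : 1 ≤ t := by
        by_contra hlt
        push Not at hlt
        have : α * t ≤ 0 := by nlinarith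
        linarith
      nlinarith

/-! ### The remainder of the odd decoupling sieve at a squarefree modulus -/

variable {k : ℕ} {f : Fin k → ℤ[X]} {m : Fin k} {Ω Φ : ℕ → Finset ℕ} {α β : ℤ}

/-- **The remainder of the odd decoupling sieve at a squarefree modulus.**  For `d` squarefree
with all prime factors `< z`, `z > α`, the count `#{n ∈ ℬ : n mod q ∈ Ω q ∀ q ∣ d}` is within
`S^{ω(d)} E` of `g(d) X`, `X = #{b ∈ roughIcc z (αx+β) : Ω(b) odd}/φ(α)`, whenever `E` bounds the
discrepancy of the odd `z`-rough numbers `≤ αx + β` in every reduced class modulo `αd` against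
their (coprime) total over `φ(αd)` (split over the `∏ #Ω q ≤ S^{ω(d)}` admissible classes
`c mod d`, each a reduced class `αc + β mod αd`; `φ(αd) = φ(α) ∏ #Φ q`; rough numbers are prime to
`αd`). [folklore] -/
theorem abs_card_classes_sub_le (hf : IsBatemanHornSystem f)
    (hΩ : ∀ p, Ω p = (range p).filter (fun c : ℕ => ¬ ((p : ℤ) ∣ (f m).eval (c : ℤ)) ∧
      ∃ i, i ≠ m ∧ (p : ℤ) ∣ (f i).eval (c : ℤ)))
    (hΦ : ∀ p, Φ p = (range p).filter (fun c : ℕ => ¬ ((p : ℤ) ∣ (f m).eval (c : ℤ))))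
    (hα : 0 < α) (hfm : ∀ n : ℤ, (f m).eval n = α * n + β)
    (hαβ : ∀ p : ℕ, p.Prime → (p : ℤ) ∣ α → ¬ ((p : ℤ) ∣ β))
    {g : ArithmeticFunction ℝ}
    (hg : ∀ d : ℕ, d ≠ 0 → g d = ∏ p ∈ d.primeFactors, (#(Ω p) : ℝ) / (#(Φ p) : ℝ))
    {S : ℕ} (hS : ∀ p : ℕ, p.Prime → #(Ω p) ≤ S)
    {x z d : ℕ} (hd : Squarefree d) (hzβ : β < z)
    (hMz : ∀ p : ℕ, p.Prime → p ∣ α.toNat * d → p < z) {E : ℝ}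
    (hE : ∀ a : ℕ, a.Coprime (α.toNat * d) →
      |(#((roughIcc z (α * x + β).toNat).filter (fun b : ℕ =>
          Odd (ArithmeticFunction.cardFactors b) ∧ b ≡ a [MOD α.toNat * d])) : ℝ) -
        (#((roughIcc z (α * x + β).toNat).filter (fun b : ℕ =>
          Odd (ArithmeticFunction.cardFactors b) ∧ b.Coprime (α.toNat * d))) : ℝ) /
          Nat.totient (α.toNat * d)| ≤ E) :
    |(#(((Icc 1 x).filter (fun n : ℕ => (0 < α * n + β ∧
        ∀ p ∈ range z, p.Prime → ¬ ((p : ℤ) ∣ α * n + β)) ∧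
          Odd (ArithmeticFunction.cardFactors (α * n + β).toNat))).filter
        (fun n : ℕ => ∀ q ∈ d.primeFactors, n % q ∈ Ω q)) : ℝ) -
        g d * ((#((roughIcc z (α * x + β).toNat).filter (fun b : ℕ =>
          Odd (ArithmeticFunction.cardFactors b))) : ℝ) / Nat.totient α.toNat)| ≤
      (S : ℝ) ^ ArithmeticFunction.cardDistinctFactors d * E := by
  have hd0 : d ≠ 0 := hd.ne_zero
  have hα'0 : 0 < α.toNat := by omega
  haveI : NeZero (α.toNat * d) := ⟨Nat.mul_ne_zero hα'0.ne' hd0⟩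
  set y : ℕ := (α * x + β).toNat with hy
  set T := (Icc 1 x).filter (fun n : ℕ => (0 < α * n + β ∧
      ∀ p ∈ range z, p.Prime → ¬ ((p : ℤ) ∣ α * n + β)) ∧
        Odd (ArithmeticFunction.cardFactors (α * n + β).toNat)) with hT
  set Cd := (range d).filter (fun c => ∀ q ∈ d.primeFactors, c % q ∈ Ω q) with hCd
  set Ro : ℝ := (#((roughIcc z y).filter (fun b : ℕ =>
    Odd (ArithmeticFunction.cardFactors b))) : ℝ) with hRo
  set Md : ℝ := Ro / Nat.totient (α.toNat * d) with hMd
  -- the coprimality condition is vacuous on the rough numbers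
  have hcop : (#((roughIcc z y).filter (fun b : ℕ =>
      Odd (ArithmeticFunction.cardFactors b) ∧ b.Coprime (α.toNat * d))) : ℝ) = Ro := by
    rw [hRo, filter_and_coprime_eq hMz]
  -- the classwise estimate
  have hclass : ∀ c ∈ Cd, |(#(T.filter (fun n : ℕ => n % d = c)) : ℝ) - Md| ≤ E := by
    intro c hc
    rw [hCd, mem_filter, mem_range] at hc
    obtain ⟨hcd, hcΩ⟩ := hc
    have hc' : ∀ q ∈ d.primeFactors, ¬ ((q : ℤ) ∣ α * c + β) := by
      intro q hq hdvd
      have h1 := hcΩ q hq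
      rw [hΩ, mem_filter] at h1
      refine h1.2.1 ?_
      rw [← dvd_eval_iff_dvd_eval_mod, hfm]
      exact hdvd
    obtain ⟨u, hu⟩ := isUnit_linear_class hα hαβ hd0 hc'
    have ha : (((u : ZMod (α.toNat * d)).val : ℕ) : ZMod (α.toNat * d)) =
        ((α * c + β : ℤ) : ZMod (α.toNat * d)) := by
      rw [ZMod.natCast_zmod_val, hu]
    rw [hT, card_filter_mod_eq hα hcd hzβ ha, hMd, ← hcop]
    exact hE _ (ZMod.val_coe_unit_coprime u)
  -- the main term `g(d) X = #Cd · Md`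
  have hCd_card : (#Cd : ℝ) = ∏ q ∈ d.primeFactors, (#(Ω q) : ℝ) := by
    rw [hCd, card_classes_eq_prod Ω (fun p _ => lt_of_mem_Ω hΩ p) hd, Nat.cast_prod]
  have hΦpos : ∀ q ∈ d.primeFactors, (0 : ℝ) < #(Φ q) := fun q hq => by
    exact_mod_cast (Nat.zero_le _).trans_lt
      (card_Ω_lt_card_Φ hf hΩ hΦ (Nat.prime_of_mem_primeFactors hq))
  have hprodpos : (0 : ℝ) < ∏ q ∈ d.primeFactors, (#(Φ q) : ℝ) := prod_pos hΦpos
  have hφpos : (0 : ℝ) < Nat.totient α.toNat := by exact_mod_cast Nat.totient_pos.mpr hα'0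
  have hmain : g d * (Ro / Nat.totient α.toNat) = #Cd * Md := by
    rw [hMd, totient_mul_eq hΦ hα hfm hαβ hd, hg d hd0, prod_div_distrib, hCd_card]
    ring
  -- split over the classes and sum the classwise estimates
  have hsplit : (#(T.filter (fun n : ℕ => ∀ q ∈ d.primeFactors, n % q ∈ Ω q)) : ℝ) =
      ∑ c ∈ Cd, (#(T.filter (fun n : ℕ => n % d = c)) : ℝ) := by
    rw [card_filter_forall_mem_eq_sum T Ω hd0, Nat.cast_sum]
  have hCdS : (#Cd : ℝ) ≤ (S : ℝ) ^ ArithmeticFunction.cardDistinctFactors d := by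
    have h1 : #Cd ≤ S ^ ArithmeticFunction.cardDistinctFactors d := by
      rw [hCd, card_classes_eq_prod Ω (fun p _ => lt_of_mem_Ω hΩ p) hd]
      exact prod_card_le_pow Ω hS d
    exact_mod_cast h1
  have hE0 : 0 ≤ E := by
    have h1 := hE 1 (Nat.coprime_one_left _)
    exact (abs_nonneg _).trans h1
  rw [hmain, hsplit, show (#Cd : ℝ) * Md = ∑ c ∈ Cd, Md by rw [sum_const, nsmul_eq_mul],
    ← sum_sub_distrib]
  calc |∑ c ∈ Cd, ((#(T.filter (fun n : ℕ => n % d = c)) : ℝ) - Md)|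
      ≤ ∑ c ∈ Cd, |(#(T.filter (fun n : ℕ => n % d = c)) : ℝ) - Md| := abs_sum_le_sum_abs _ _
    _ ≤ ∑ c ∈ Cd, E := sum_le_sum hclass
    _ = #Cd * E := by rw [sum_const, nsmul_eq_mul]
    _ ≤ (S : ℝ) ^ ArithmeticFunction.cardDistinctFactors d * E :=
        mul_le_mul_of_nonneg_right hCdS hE0

end SieveDecouplingOdd

/-- **Sub-goal (the remainder of the odd decoupling sieve at a squarefree modulus)** of the stub
`stub_sieveDecouplingOdd_of_roughCellsBV` (crux stmt-Parity-15629, line `birth`): the inequality of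
`SieveDecouplingOdd.abs_card_classes_sub_le` with the classes `Ω p`, `Φ p` written out. [folklore] -/
theorem stub_decouplingOddClasses :
    ∀ (k : ℕ) (f : Fin k → Polynomial ℤ), Literature.NumberTheory.Sieve.IsBatemanHornSystem f → ∀ (m
    : Fin k) (α β : ℤ), 0 < α → (∀ n : ℤ, (f m).eval n = α * n + β) → (∀ p : ℕ, p.Prime → (p : ℤ) ∣
    α → ¬ ((p : ℤ) ∣ β)) → ∀ (g : ArithmeticFunction ℝ), (∀ d : ℕ, d ≠ 0 → g d = ∏ p ∈
    d.primeFactors, ((((Finset.range p).filter (fun c : ℕ => ¬ ((p : ℤ) ∣ (f m).eval (c : ℤ)) ∧ ∃ i,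
    i ≠ m ∧ (p : ℤ) ∣ (f i).eval (c : ℤ))).card : ℕ) : ℝ) / ((((Finset.range p).filter (fun c : ℕ =>
    ¬ ((p : ℤ) ∣ (f m).eval (c : ℤ)))).card : ℕ) : ℝ)) → ∀ (S : ℕ), (∀ p : ℕ, p.Prime →
    ((Finset.range p).filter (fun c : ℕ => ¬ ((p : ℤ) ∣ (f m).eval (c : ℤ)) ∧ ∃ i, i ≠ m ∧ (p : ℤ) ∣
    (f i).eval (c : ℤ))).card ≤ S) → ∀ (x z d : ℕ), Squarefree d → β < z → (∀ p : ℕ, p.Prime → p ∣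
    α.toNat * d → p < z) → ∀ (E : ℝ), (∀ a : ℕ, a.Coprime (α.toNat * d) →
    |((((Literature.NumberTheory.Sieve.roughIcc z (α * x + β).toNat).filter (fun b : ℕ => Odd
    (ArithmeticFunction.cardFactors b) ∧ Nat.ModEq (α.toNat * d) b a)).card : ℕ) : ℝ) -
    ((((Literature.NumberTheory.Sieve.roughIcc z (α * x + β).toNat).filter (fun b : ℕ => Odd
    (ArithmeticFunction.cardFactors b) ∧ b.Coprime (α.toNat * d))).card : ℕ) : ℝ) / ((Nat.totient
    (α.toNat * d) : ℕ) : ℝ)| ≤ E) → |(((((Finset.Icc 1 x).filter (fun n : ℕ => (0 < α * n + β ∧ ∀ p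
    ∈ Finset.range z, p.Prime → ¬ ((p : ℤ) ∣ α * n + β)) ∧ Odd (ArithmeticFunction.cardFactors (α *
    n + β).toNat))).filter (fun n : ℕ => ∀ q ∈ d.primeFactors, n % q ∈ (Finset.range q).filter (fun
    c : ℕ => ¬ ((q : ℤ) ∣ (f m).eval (c : ℤ)) ∧ ∃ i, i ≠ m ∧ (q : ℤ) ∣ (f i).eval (c : ℤ)))).card :
    ℕ) : ℝ) - g d * (((((Literature.NumberTheory.Sieve.roughIcc z (α * x + β).toNat).filter (fun b :
    ℕ => Odd (ArithmeticFunction.cardFactors b))).card : ℕ) : ℝ) / ((Nat.totient α.toNat : ℕ) : ℝ))|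
    ≤ (S : ℝ) ^ (ArithmeticFunction.cardDistinctFactors d) * E
 :=
  fun _ f hf m _ _ hα hfm hαβ _ hg _ hS _ _ _ hd hzβ hMz _ hE =>
    SieveDecouplingOdd.abs_card_classes_sub_le hf (m := m)
      (Ω := fun p => (Finset.range p).filter (fun c : ℕ => ¬ ((p : ℤ) ∣ (f m).eval (c : ℤ)) ∧
        ∃ i, i ≠ m ∧ (p : ℤ) ∣ (f i).eval (c : ℤ)))
      (Φ := fun p => (Finset.range p).filter (fun c : ℕ => ¬ ((p : ℤ) ∣ (f m).eval (c : ℤ))))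
      (fun _ => rfl) (fun _ => rfl) hα hfm hαβ hg hS hd hzβ hMz hE

end Summit.Parity.BatemanHorn.Cruxes.OddSectorShareLinear.Birth

end
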